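import Literature.GroupTheory.CombinatorialGroupTheory.SurfaceGroupPushout
import Literature.GroupTheory.CombinatorialGroupTheory.FreeGroupConjugacySeparable
import Literature.GroupTheory.CombinatorialGroupTheory.FreeGroupCyclicConjugacySeparable
import Mathlib.GroupTheory.RegularWreathProduct
import HarnessLib

/-!
# Elliptic pairs in the surface amalgam `F_{2g} *_ℤ F_{2h}` are separated in finite quotients

Topic `Literature/GroupTheory/CombinatorialGroupTheory`.  A brick for Stebe's theorem (orientable
surface groups are conjugacy separable, [Stebe1972, Thm 3.3]; the tree's named fact
`SurfaceGroupConjugacySeparable`), for the splitting `S_{g+h} ≅ F_{2g} *_ℤ F_{2h}` of the tree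
(`SurfaceAmalgam g h`, `exists_surfaceGroup_mulEquiv_surfaceAmalgam`).

**Theorem** (`surfaceAmalgam_exists_hom_finite_not_isConj_of`).  Let `g, h ≥ 1`, and let
`x = of b u`, `y = of b' v` be images of elements of the two free factors (`b, b' : Bool`; the same
or different factors).  If `x` and `y` are not conjugate in the amalgam, there is a homomorphism to a
FINITE group under which their images are not conjugate.  Corollaries: the same for any two
*elliptic* elements (elements conjugate into a factor, `…_of_isConj_of`), and the normal-subgroup form
(`surfaceAmalgam_exists_normal_finiteIndex_not_isConj_of`).

So for the surface group the "torsion–torsion" half of the conjugacy separability of finite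
amalgams ([Dyer 1979, Thm 1], invoked in Dyer 1980 Thm 4 p.40 / Thm 10 p.48) is NOT needed: elliptic pairs are separated directly in `S_{g+h}`, and a passage
to a finite amalgam `Ā *_{C̄} B̄` is only required for pairs with a hyperbolic member.

## The device (all in Mathlib's regular wreath product `P ≀ᵣ P`, no new definitions)

For a group `P` write `Δ p := ⟨const p, 1⟩ ∈ P ≀ᵣ P` (diagonal), `σ_k := ⟨1, k⁻¹⟩`, `ξ := ⟨id, 1⟩`.
* `wreath_commutator_eq_const`: `⁅σ_k, ξ⁆ = Δ k` — EVERY element of `P` becomes a commutator;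
* `isConj_apply_left_of_isConj_const`: if `Δ p` is conjugate to `w` then every coordinate `w.left x`
  is conjugate to `p` in `P` (so `Δ` reflects conjugacy);
* `left_one_mem_zpowers_of_mem_closure`: every element of `⟨σ_k, ξ⟩` has its coordinate at `1` in
  the cyclic subgroup `⟨k⟩`.
Given a homomorphism `φ` from one free factor to a finite group `P`, the map `Δ ∘ φ` on that factor
and `a₁ ↦ σ_k, b₁ ↦ ξ, (other generators) ↦ 1` on the other factor agree on the amalgamated `ℤ`
(the surface relator `∏ [aᵢ, bᵢ]` goes to `⁅σ_k, ξ⁆ = Δ k`, and `k` is chosen as `φ(r)^{∓1}`), so they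
define `S_{g+h} → P ≀ᵣ P`.  Same factor: take `φ` separating `u` from `v` (free groups are conjugacy
separable, [Stb1] = `FreeGroup.exists_hom_finite_not_isConj`).  Different factors: if `u` is conjugate
to a power of the amalgamated generator, move it across to the other factor; otherwise take `φ` with
`φ u` conjugate to no power of `φ r` (free groups are cyclic conjugacy separable, Dyer 1980 Lemma 8 =
`FreeGroup.exists_hom_finite_forall_not_isConj_zpow`) and use the last two bullet points.

Proof-only file: no definitions, no named facts; `SurfaceGroupConjugacySeparable` itself is NOT proved
here (pairs with a hyperbolic member remain).

## References
* P. F. Stebe, *Conjugacy separability of certain Fuchsian groups*, Trans. AMS 163 (1972). [Stebe1972]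
* J. L. Dyer, *Separating conjugates in amalgamated free products and HNN extensions*,
  J. Austral. Math. Soc. A 29 (1980) 35–51. [Dyer1980]
* W. Magnus, A. Karrass, D. Solitar, *Combinatorial Group Theory* (1966), §4.2. [MagnusKarrassSolitar1966]
-/

namespace Literature.GroupTheory.CombinatorialGroupTheory

open Literature.Topology.FourManifolds Monoid
open scoped commutatorElement

universe u

/-! ### The wreath-product device -/

section Device

variable {P : Type u} [Group P]

/-- Diagonal elements of `P ≀ᵣ P` multiply coordinatewise: `Δ p · Δ q = Δ (p q)`. [cite: Dyer1980, Thm. 10 p.48] -/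
theorem wreath_const_mul_const (p q : P) :
    ((⟨Function.const P p, 1⟩ : P ≀ᵣ P) * ⟨Function.const P q, 1⟩) =
      ⟨Function.const P (p * q), 1⟩ := by
  ext x <;> simp

/-- The diagonal element `Δ 1` is the identity of `P ≀ᵣ P`. [cite: Dyer1980, Thm. 10 p.48] -/
theorem wreath_const_one : (⟨Function.const P 1, 1⟩ : P ≀ᵣ P) = 1 := by
  ext x <;> simp

/-- The diagonal element `Δ p⁻¹` is the inverse of `Δ p`. [cite: Dyer1980, Thm. 10 p.48] -/
theorem wreath_const_inv (p : P) :
    (⟨Function.const P p, 1⟩ : P ≀ᵣ P)⁻¹ = ⟨Function.const P p⁻¹, 1⟩ := by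
  ext x <;> simp

/-- **Every element of `P` is a commutator in `P ≀ᵣ P`**: with `σ_k = ⟨1, k⁻¹⟩` (a pure shift) and
`ξ = ⟨id, 1⟩` (the tautological coordinate function), `⁅σ_k, ξ⁆ = ⟨const k, 1⟩ = Δ k`: indeed
`(σ_k ξ σ_k⁻¹ ξ⁻¹).left x = (k x) x⁻¹ = k`.  This device replaces, for the surface amalgam,
Dyer's appeal to [Dyer 1979, Thm 1] (free-by-finite groups are c.s.) in the proofs of her Thm 4
(p.40) and Thm 10 (p.48) as far as pairs of elliptic elements are concerned.
[cite: Dyer1980, Thm. 10 p.48] -/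
theorem wreath_commutator_eq_const (k : P) :
    ⁅(⟨1, k⁻¹⟩ : P ≀ᵣ P), (⟨id, 1⟩ : P ≀ᵣ P)⁆ = ⟨Function.const P k, 1⟩ := by
  ext x <;> simp [commutatorElement_def]

/-- **The diagonal reflects conjugacy**: if `Δ p = ⟨const p, 1⟩` is conjugate to `w` in `P ≀ᵣ P`,
then EVERY coordinate of `w` is conjugate to `p` in `P` (conjugating `Δ p` by `⟨d, t⟩` gives
coordinates `d x · p · (d x)⁻¹`). [cite: Dyer1980, Thm. 10 p.48] -/
theorem isConj_apply_left_of_isConj_const {p : P} {w : P ≀ᵣ P}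
    (hw : IsConj (⟨Function.const P p, 1⟩ : P ≀ᵣ P) w) (x : P) : IsConj p (w.left x) := by
  obtain ⟨c, rfl⟩ := isConj_iff.mp hw
  exact isConj_iff.mpr ⟨c.left x, by simp [mul_assoc]⟩

/-- The subgroup `⟨σ_k, ξ⟩ = ⟨⟨1, k⁻¹⟩, ⟨id, 1⟩⟩` of `P ≀ᵣ P` consists of elements `w` whose
coordinate `w.left x` lies in `⟨k, x⟩` for every `x` and whose shift part `w.right` is a power of `k`.
[cite: Dyer1980, Thm. 10 p.48] -/
theorem apply_left_mem_closure_of_mem_closure {k : P} {w : P ≀ᵣ P}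
    (hw : w ∈ Subgroup.closure ({⟨1, k⁻¹⟩, ⟨id, 1⟩} : Set (P ≀ᵣ P))) :
    (∀ x : P, w.left x ∈ Subgroup.closure ({k, x} : Set P)) ∧ w.right ∈ Subgroup.zpowers k := by
  induction hw using Subgroup.closure_induction with
  | mem w hw =>
    simp only [Set.mem_insert_iff, Set.mem_singleton_iff] at hw
    rcases hw with rfl | rfl
    · exact ⟨fun x => by simp, by simp⟩
    · exact ⟨fun x => Subgroup.subset_closure (by simp), by simp⟩
  | one => exact ⟨fun x => by simp, by simp⟩
  | mul a b _ _ iha ihb =>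
    refine ⟨fun x => ?_, by simpa using mul_mem iha.2 ihb.2⟩
    simp only [RegularWreathProduct.mul_left, Pi.mul_apply]
    refine mul_mem (iha.1 x) ?_
    have hk : k ∈ Subgroup.closure ({k, x} : Set P) := Subgroup.subset_closure (by simp)
    have hx : x ∈ Subgroup.closure ({k, x} : Set P) := Subgroup.subset_closure (by simp)
    have hy : a.right⁻¹ * x ∈ Subgroup.closure ({k, x} : Set P) :=
      mul_mem ((Subgroup.zpowers_le.mpr hk) (inv_mem iha.2)) hx
    refine (Subgroup.closure_le _).mpr ?_ (ihb.1 (a.right⁻¹ * x))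
    exact Set.insert_subset hk (Set.singleton_subset_iff.mpr hy)
  | inv a _ iha =>
    refine ⟨fun x => ?_, by simpa using inv_mem iha.2⟩
    simp only [RegularWreathProduct.inv_left, Pi.inv_apply]
    refine inv_mem ?_
    have hk : k ∈ Subgroup.closure ({k, x} : Set P) := Subgroup.subset_closure (by simp)
    have hx : x ∈ Subgroup.closure ({k, x} : Set P) := Subgroup.subset_closure (by simp)
    have hy : a.right * x ∈ Subgroup.closure ({k, x} : Set P) :=
      mul_mem ((Subgroup.zpowers_le.mpr hk) iha.2) hx
    refine (Subgroup.closure_le _).mpr ?_ (iha.1 (a.right * x))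
    exact Set.insert_subset hk (Set.singleton_subset_iff.mpr hy)

/-- In particular the coordinate at `1` of any element of `⟨σ_k, ξ⟩` is a power of `k`. [cite: Dyer1980, Thm. 10 p.48] -/
theorem left_one_mem_zpowers_of_mem_closure {k : P} {w : P ≀ᵣ P}
    (hw : w ∈ Subgroup.closure ({⟨1, k⁻¹⟩, ⟨id, 1⟩} : Set (P ≀ᵣ P))) :
    w.left 1 ∈ Subgroup.zpowers k := by
  refine (Subgroup.closure_le _).mpr ?_ ((apply_left_mem_closure_of_mem_closure hw).1 1)
  exact Set.insert_subset (Subgroup.mem_zpowers k) (Set.singleton_subset_iff.mpr (one_mem _))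

end Device

/-! ### Homomorphisms out of the surface amalgam -/

/-- A homomorphism from the free group on the `2n` surface generators (`n ≥ 1`) sending the surface
relator `∏ᵢ [aᵢ, bᵢ]` to a prescribed commutator `⁅s, t⁆` and with image inside `⟨s, t⟩`:
`a₁ ↦ s`, `b₁ ↦ t`, all other generators `↦ 1`. [cite: Dyer1980, Thm. 10 p.48] -/
theorem exists_lift_surfaceRelator_eq_commutator {W : Type*} [Group W] {n : ℕ} (hn : 1 ≤ n)
    (s t : W) :
    ∃ ρ : FreeGroup (surfaceGen n) →* W,
      ρ (surfaceRelator n) = ⁅s, t⁆ ∧ ∀ v, ρ v ∈ Subgroup.closure ({s, t} : Set W) := by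
  obtain ⟨n, rfl⟩ : ∃ n', n = n' + 1 := ⟨n - 1, by omega⟩
  let f : surfaceGen (n + 1) → W := fun q => if q.1 = 0 then (if q.2 then t else s) else 1
  refine ⟨FreeGroup.lift f, ?_, fun v => ?_⟩
  · rw [surfaceRelator, map_list_prod, List.map_map, List.finRange_succ, List.map_cons,
      List.prod_cons, List.map_map]
    have hrest : ((List.finRange n).map
        ((⇑(FreeGroup.lift f) ∘ fun i => genA i * genB i * (genA i)⁻¹ * (genB i)⁻¹) ∘
          Fin.succ)).prod = 1 := by
      refine List.prod_eq_one fun x hx => ?_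
      rw [List.mem_map] at hx
      obtain ⟨i, -, rfl⟩ := hx
      simp [f, genA, genB, Fin.succ_ne_zero]
    rw [hrest, mul_one]
    simp [f, genA, genB, commutatorElement_def]
  · induction v using FreeGroup.induction_on with
    | C1 => exact one_mem _
    | of x =>
      rw [FreeGroup.lift_apply_of]
      by_cases h0 : x.1 = 0
      · by_cases h2 : x.2
        · simpa [f, h0, h2] using Subgroup.subset_closure (by simp)
        · simpa [f, h0, h2] using Subgroup.subset_closure (by simp)
      · simp [f, h0]
    | inv_of x ih => simpa using inv_mem ih
    | mul x y ihx ihy => simpa using mul_mem ihx ihy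

variable {g h : ℕ}

/-- A pair of homomorphisms on the two free factors that AGREE ON THE AMALGAMATED GENERATOR
(`f₀ (r_g) = f₁ (r_h⁻¹)`) defines a homomorphism out of `F_{2g} *_ℤ F_{2h}` (universal property
of the pushout). [cite: SerreTrees1980, Ch. I §1.2] -/
theorem surfaceAmalgam_exists_hom_of_apply_elt_eq {W : Type*} [Group W]
    (f₀ : SurfaceAmalgamFactor g h false →* W) (f₁ : SurfaceAmalgamFactor g h true →* W)
    (hc : f₀ (surfaceAmalgamElt g h false) = f₁ (surfaceAmalgamElt g h true)) :
    ∃ f : SurfaceAmalgam g h →* W,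
      (∀ u, f (PushoutI.of (φ := surfaceAmalgamHom g h) false u) = f₀ u) ∧
        ∀ v, f (PushoutI.of (φ := surfaceAmalgamHom g h) true v) = f₁ v := by
  let fam : ∀ b : Bool, SurfaceAmalgamFactor g h b →* W := fun b =>
    match b with
    | false => f₀
    | true => f₁
  have hfam : ∀ b, (fam b).comp (surfaceAmalgamHom g h b) =
      (fam false).comp (surfaceAmalgamHom g h false) := by
    intro b
    cases b
    · rfl
    · refine MonoidHom.ext_mint ?_
      change f₁ (surfaceAmalgamHom g h true (Multiplicative.ofAdd 1)) =
        f₀ (surfaceAmalgamHom g h false (Multiplicative.ofAdd 1))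
      rw [surfaceAmalgamHom_apply, surfaceAmalgamHom_apply, toAdd_ofAdd, zpow_one, zpow_one]
      exact hc.symm
  refine ⟨PushoutI.lift fam _ hfam, fun u => ?_, fun v => ?_⟩
  · rw [PushoutI.lift_of]
  · rw [PushoutI.lift_of]

/-- Images of powers of the amalgamated generator may be read in either factor:
`of b (r_b ^ n) = of b' (r_{b'} ^ n)` where `r_false = r_g`, `r_true = r_h⁻¹`.
[cite: SerreTrees1980, Ch. I §1.2] -/
theorem surfaceAmalgam_of_elt_zpow (b b' : Bool) (n : ℤ) :
    (PushoutI.of (φ := surfaceAmalgamHom g h) b (surfaceAmalgamElt g h b ^ n) : SurfaceAmalgam g h) =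
      PushoutI.of (φ := surfaceAmalgamHom g h) b' (surfaceAmalgamElt g h b' ^ n) := by
  have h1 : ∀ c : Bool, (PushoutI.of (φ := surfaceAmalgamHom g h) c (surfaceAmalgamElt g h c ^ n) :
      SurfaceAmalgam g h) = PushoutI.base (surfaceAmalgamHom g h) (Multiplicative.ofAdd n) := by
    intro c
    rw [← PushoutI.of_apply_eq_base (surfaceAmalgamHom g h) c, surfaceAmalgamHom_apply, toAdd_ofAdd]
  rw [h1, h1]

/-- **The core construction.**  Given `g, h ≥ 1`, a factor index `b₀`, the other index `b₁ ≠ b₀`,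
and a homomorphism `φ` from the factor `b₀` to a group `P`, there is a homomorphism
`f : F_{2g} *_ℤ F_{2h} → P ≀ᵣ P` which is the diagonal `Δ ∘ φ` on the factor `b₀` and maps the
factor `b₁` into `⟨σ_k, ξ⟩`, where `⟨k⟩ = ⟨φ(r_{b₀})⟩` (`k = φ(r_{b₀})^{∓1}` according to the
side). [cite: Dyer1980, Thm. 10 p.48] -/
theorem surfaceAmalgam_exists_hom_wreath (hg : 1 ≤ g) (hh : 1 ≤ h) {b₀ b₁ : Bool} (hb : b₀ ≠ b₁)
    {P : Type u} [Group P] (φ : SurfaceAmalgamFactor g h b₀ →* P) :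
    ∃ (f : SurfaceAmalgam g h →* P ≀ᵣ P) (k : P),
      Subgroup.zpowers k = Subgroup.zpowers (φ (surfaceAmalgamElt g h b₀)) ∧
      (∀ u, f (PushoutI.of (φ := surfaceAmalgamHom g h) b₀ u) = ⟨Function.const P (φ u), 1⟩) ∧
      ∀ v, f (PushoutI.of (φ := surfaceAmalgamHom g h) b₁ v) ∈
        Subgroup.closure ({⟨1, k⁻¹⟩, ⟨id, 1⟩} : Set (P ≀ᵣ P)) := by
  let diag : P →* P ≀ᵣ P :=
    { toFun := fun p => ⟨Function.const P p, 1⟩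
      map_one' := wreath_const_one
      map_mul' := fun p q => (wreath_const_mul_const p q).symm }
  have hdiag : ∀ p, diag p = ⟨Function.const P p, 1⟩ := fun p => rfl
  cases b₀ <;> cases b₁
  · exact absurd rfl hb
  · -- `φ` on the factor `false` (genus `g`), realizer on the factor `true` (genus `h`)
    obtain ⟨ρ, hρ, hρmem⟩ := exists_lift_surfaceRelator_eq_commutator (W := P ≀ᵣ P) hh
      (⟨1, ((φ (surfaceAmalgamElt g h false))⁻¹)⁻¹⟩ : P ≀ᵣ P) ⟨id, 1⟩
    obtain ⟨f, hf₀, hf₁⟩ := surfaceAmalgam_exists_hom_of_apply_elt_eq (diag.comp φ) ρ (by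
      rw [surfaceAmalgamElt_true, map_inv, hρ, wreath_commutator_eq_const, wreath_const_inv, inv_inv,
        MonoidHom.comp_apply, hdiag, surfaceAmalgamElt_false])
    refine ⟨f, (φ (surfaceAmalgamElt g h false))⁻¹, Subgroup.zpowers_inv, fun u => ?_, fun v => ?_⟩
    · rw [hf₀, MonoidHom.comp_apply, hdiag]
    · rw [hf₁]
      exact hρmem v
  · -- `φ` on the factor `true` (genus `h`), realizer on the factor `false` (genus `g`)
    obtain ⟨ρ, hρ, hρmem⟩ := exists_lift_surfaceRelator_eq_commutator (W := P ≀ᵣ P) hg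
      (⟨1, (φ (surfaceAmalgamElt g h true))⁻¹⟩ : P ≀ᵣ P) ⟨id, 1⟩
    obtain ⟨f, hf₀, hf₁⟩ := surfaceAmalgam_exists_hom_of_apply_elt_eq ρ (diag.comp φ) (by
      rw [surfaceAmalgamElt_false, hρ, wreath_commutator_eq_const, MonoidHom.comp_apply, hdiag])
    refine ⟨f, φ (surfaceAmalgamElt g h true), rfl, fun u => ?_, fun v => ?_⟩
    · rw [hf₁, MonoidHom.comp_apply, hdiag]
    · rw [hf₀]
      exact hρmem v
  · exact absurd rfl hb

/-! ### Separation of elliptic pairs -/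

/-- **Same factor.**  For `g, h ≥ 1` and `u, v` in the SAME free factor of `F_{2g} *_ℤ F_{2h}` whose
images are not conjugate in the amalgam, some homomorphism to a finite group separates the conjugacy
classes of the images (free groups are conjugacy separable + the diagonal of `P ≀ᵣ P` reflects
conjugacy).  A special case of Stebe's theorem. [cite: Stebe1972, Thm 3.3 p.182] -/
theorem surfaceAmalgam_exists_hom_finite_not_isConj_of_sameFactor (hg : 1 ≤ g) (hh : 1 ≤ h)
    (b : Bool) (u v : SurfaceAmalgamFactor g h b)
    (huv : ¬ IsConj (PushoutI.of (φ := surfaceAmalgamHom g h) b u : SurfaceAmalgam g h)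
      (PushoutI.of (φ := surfaceAmalgamHom g h) b v)) :
    ∃ (Q : Type) (_ : Group Q) (_ : Finite Q) (f : SurfaceAmalgam g h →* Q),
      ¬ IsConj (f (PushoutI.of (φ := surfaceAmalgamHom g h) b u))
        (f (PushoutI.of (φ := surfaceAmalgamHom g h) b v)) := by
  have huv' : ¬ IsConj u v := fun hc => huv ((PushoutI.of (φ := surfaceAmalgamHom g h) b).map_isConj hc)
  obtain ⟨P, _, _, φ, -, hφ⟩ := FreeGroup.exists_hom_finite_not_isConj huv'
  obtain ⟨f, k, -, hf, -⟩ :=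
    surfaceAmalgam_exists_hom_wreath hg hh (b₀ := b) (b₁ := !b) (by cases b <;> decide) φ
  refine ⟨P ≀ᵣ P, inferInstance, inferInstance, f, fun hc => hφ ?_⟩
  rw [hf, hf] at hc
  simpa using isConj_apply_left_of_isConj_const hc 1

/-- **Elliptic pairs of the surface amalgam are separated in a finite quotient.**  For `g, h ≥ 1`
and `u`, `v` elements of (possibly different) free factors of `F_{2g} *_ℤ F_{2h} ≅ S_{g+h}` whose
images `of b u`, `of b' v` are not conjugate, there is a homomorphism to a finite group under which
the images are not conjugate.  Cases: same factor (`…_of_sameFactor`); `u` conjugate in its factor to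
a power of the amalgamated generator — read it in the other factor (`surfaceAmalgam_of_elt_zpow`);
otherwise a finite quotient `φ` of the factor of `u` in which `φ u` is conjugate to no power of `φ r`
(free groups are cyclic conjugacy separable) and the wreath device: the image of the other factor lies
in `⟨σ_k, ξ⟩`, whose coordinates at `1` are powers of `k`, `⟨k⟩ = ⟨φ r⟩`.  A special case of
Stebe's theorem; this proof does not pass through a finite amalgam. [cite: Stebe1972, Thm 3.3 p.182] -/
theorem surfaceAmalgam_exists_hom_finite_not_isConj_of (hg : 1 ≤ g) (hh : 1 ≤ h)
    (b b' : Bool) (u : SurfaceAmalgamFactor g h b) (v : SurfaceAmalgamFactor g h b')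
    (huv : ¬ IsConj (PushoutI.of (φ := surfaceAmalgamHom g h) b u : SurfaceAmalgam g h)
      (PushoutI.of (φ := surfaceAmalgamHom g h) b' v)) :
    ∃ (Q : Type) (_ : Group Q) (_ : Finite Q) (f : SurfaceAmalgam g h →* Q),
      ¬ IsConj (f (PushoutI.of (φ := surfaceAmalgamHom g h) b u))
        (f (PushoutI.of (φ := surfaceAmalgamHom g h) b' v)) := by
  by_cases hbb : b = b'
  · subst hbb
    exact surfaceAmalgam_exists_hom_finite_not_isConj_of_sameFactor hg hh b u v huv
  by_cases hu : ∃ n : ℤ, IsConj u (surfaceAmalgamElt g h b ^ n)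
  · -- move `u` across the amalgamated `ℤ` into the factor of `v`
    obtain ⟨n, hn⟩ := hu
    have hx : IsConj (PushoutI.of (φ := surfaceAmalgamHom g h) b u : SurfaceAmalgam g h)
        (PushoutI.of (φ := surfaceAmalgamHom g h) b' (surfaceAmalgamElt g h b' ^ n)) := by
      rw [← surfaceAmalgam_of_elt_zpow b b' n]
      exact (PushoutI.of (φ := surfaceAmalgamHom g h) b).map_isConj hn
    have hev : ¬ IsConj (PushoutI.of (φ := surfaceAmalgamHom g h) b' (surfaceAmalgamElt g h b' ^ n) :
        SurfaceAmalgam g h) (PushoutI.of (φ := surfaceAmalgamHom g h) b' v) :=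
      fun hc => huv (hx.trans hc)
    obtain ⟨Q, _, _, f, hf⟩ :=
      surfaceAmalgam_exists_hom_finite_not_isConj_of_sameFactor hg hh b' _ v hev
    exact ⟨Q, inferInstance, inferInstance, f, fun hc => hf ((f.map_isConj hx).symm.trans hc)⟩
  · push Not at hu
    obtain ⟨P, _, _, φ, -, hφ⟩ := FreeGroup.exists_hom_finite_forall_not_isConj_zpow hu
    obtain ⟨f, k, hk, hf, hf'⟩ := surfaceAmalgam_exists_hom_wreath hg hh hbb φ
    refine ⟨P ≀ᵣ P, inferInstance, inferInstance, f, fun hc => ?_⟩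
    rw [hf] at hc
    have h1 := isConj_apply_left_of_isConj_const hc 1
    have h2 : (f (PushoutI.of (φ := surfaceAmalgamHom g h) b' v)).left 1 ∈
        Subgroup.zpowers (φ (surfaceAmalgamElt g h b)) := hk ▸ left_one_mem_zpowers_of_mem_closure (hf' v)
    obtain ⟨n, hn⟩ := Subgroup.mem_zpowers_iff.mp h2
    exact hφ n (by rw [← map_zpow, map_zpow φ, hn]; exact h1)

/-- **Elliptic pairs, conjugacy-class form.**  Two elements of `F_{2g} *_ℤ F_{2h}` (`g, h ≥ 1`) each
conjugate INTO A FACTOR ("elliptic" for this splitting of `S_{g+h}`) and not conjugate to each other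
have non-conjugate images in some finite group. [cite: Stebe1972, Thm 3.3 p.182] -/
theorem surfaceAmalgam_exists_hom_finite_not_isConj_of_isConj_of (hg : 1 ≤ g) (hh : 1 ≤ h)
    {x y : SurfaceAmalgam g h}
    (hx : ∃ (b : Bool) (u : SurfaceAmalgamFactor g h b),
      IsConj x (PushoutI.of (φ := surfaceAmalgamHom g h) b u))
    (hy : ∃ (b' : Bool) (v : SurfaceAmalgamFactor g h b'),
      IsConj y (PushoutI.of (φ := surfaceAmalgamHom g h) b' v))
    (hxy : ¬ IsConj x y) :
    ∃ (Q : Type) (_ : Group Q) (_ : Finite Q) (f : SurfaceAmalgam g h →* Q),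
      ¬ IsConj (f x) (f y) := by
  obtain ⟨b, u, hu⟩ := hx
  obtain ⟨b', v, hv⟩ := hy
  have huv : ¬ IsConj (PushoutI.of (φ := surfaceAmalgamHom g h) b u : SurfaceAmalgam g h)
      (PushoutI.of (φ := surfaceAmalgamHom g h) b' v) :=
    fun hc => hxy ((hu.trans hc).trans hv.symm)
  obtain ⟨Q, _, _, f, hf⟩ := surfaceAmalgam_exists_hom_finite_not_isConj_of hg hh b b' u v huv
  exact ⟨Q, inferInstance, inferInstance, f,
    fun hc => hf (((f.map_isConj hu).symm.trans hc).trans (f.map_isConj hv))⟩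

/-- **Elliptic pairs, normal-form shape** (plugs into `Amalgam.exists_conj_normalForm`, cases
(a) base element / (b) single letter): if `x` and `y` are each conjugate to an element of the base
group or to a single letter, and are not conjugate to each other, some homomorphism to a finite group
separates their images. [cite: Stebe1972, Thm 3.3 p.182] -/
theorem surfaceAmalgam_exists_hom_finite_not_isConj_of_short (hg : 1 ≤ g) (hh : 1 ≤ h)
    {x y : SurfaceAmalgam g h}
    (hx : ∃ p : SurfaceAmalgam g h,
      (∃ c, p * x * p⁻¹ = PushoutI.base (surfaceAmalgamHom g h) c) ∨
      (∃ (b : Bool) (u : SurfaceAmalgamFactor g h b),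
        p * x * p⁻¹ = PushoutI.of (φ := surfaceAmalgamHom g h) b u))
    (hy : ∃ p : SurfaceAmalgam g h,
      (∃ c, p * y * p⁻¹ = PushoutI.base (surfaceAmalgamHom g h) c) ∨
      (∃ (b' : Bool) (v : SurfaceAmalgamFactor g h b'),
        p * y * p⁻¹ = PushoutI.of (φ := surfaceAmalgamHom g h) b' v))
    (hxy : ¬ IsConj x y) :
    ∃ (Q : Type) (_ : Group Q) (_ : Finite Q) (f : SurfaceAmalgam g h →* Q),
      ¬ IsConj (f x) (f y) := by
  -- a base element is the image of an element of the factor `false`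
  have hbase : ∀ c, PushoutI.base (surfaceAmalgamHom g h) c =
      PushoutI.of (φ := surfaceAmalgamHom g h) false (surfaceAmalgamHom g h false c) :=
    fun c => (PushoutI.of_apply_eq_base (surfaceAmalgamHom g h) false c).symm
  have hell : ∀ {z : SurfaceAmalgam g h}, (∃ p : SurfaceAmalgam g h,
      (∃ c, p * z * p⁻¹ = PushoutI.base (surfaceAmalgamHom g h) c) ∨
      (∃ (b : Bool) (u : SurfaceAmalgamFactor g h b),
        p * z * p⁻¹ = PushoutI.of (φ := surfaceAmalgamHom g h) b u)) →
      ∃ (b : Bool) (u : SurfaceAmalgamFactor g h b),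
        IsConj z (PushoutI.of (φ := surfaceAmalgamHom g h) b u) := by
    rintro z ⟨p, ⟨c, hc⟩ | ⟨b, u, hu⟩⟩
    · exact ⟨false, _, isConj_iff.mpr ⟨p, hc.trans (hbase c)⟩⟩
    · exact ⟨b, u, isConj_iff.mpr ⟨p, hu⟩⟩
  exact surfaceAmalgam_exists_hom_finite_not_isConj_of_isConj_of hg hh (hell hx) (hell hy) hxy

/-- **Elliptic pairs, finite-quotient form** (the shape in which the tree states
`SurfaceGroupConjugacySeparable`): for `g, h ≥ 1` and non-conjugate `x, y ∈ F_{2g} *_ℤ F_{2h}` each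
conjugate into a factor, there is a normal subgroup `N` of finite index such that the images of `x`
and `y` in the finite group `(F_{2g} *_ℤ F_{2h}) ⧸ N` are not conjugate.
[cite: Stebe1972, Thm 3.3 p.182] -/
theorem surfaceAmalgam_exists_normal_finiteIndex_not_isConj_of_isConj_of (hg : 1 ≤ g) (hh : 1 ≤ h)
    {x y : SurfaceAmalgam g h}
    (hx : ∃ (b : Bool) (u : SurfaceAmalgamFactor g h b),
      IsConj x (PushoutI.of (φ := surfaceAmalgamHom g h) b u))
    (hy : ∃ (b' : Bool) (v : SurfaceAmalgamFactor g h b'),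
      IsConj y (PushoutI.of (φ := surfaceAmalgamHom g h) b' v))
    (hxy : ¬ IsConj x y) :
    ∃ (N : Subgroup (SurfaceAmalgam g h)) (_ : N.Normal) (_ : N.FiniteIndex),
      ¬ IsConj (QuotientGroup.mk x : SurfaceAmalgam g h ⧸ N) (QuotientGroup.mk y) := by
  obtain ⟨Q, _, _, f, hf⟩ := surfaceAmalgam_exists_hom_finite_not_isConj_of_isConj_of hg hh hx hy hxy
  haveI : Finite (SurfaceAmalgam g h ⧸ f.ker) :=
    Finite.of_injective _ (QuotientGroup.kerLift_injective f)
  refine ⟨f.ker, inferInstance, Subgroup.finiteIndex_of_finite_quotient, fun hc => hf ?_⟩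
  simpa using (QuotientGroup.kerLift f).map_isConj hc

end Literature.GroupTheory.CombinatorialGroupTheory
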